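import Mathlib
import Literature.NumberTheory.LFunctions.Zhang2022.Section17U021ChiR1Window
import Literature.NumberTheory.LFunctions.Zhang2022.Section17U021ChiR1WindowXi
import Literature.NumberTheory.LFunctions.Zhang2022.Section17U021ChiR1M1Sum
import Literature.NumberTheory.LFunctions.Zhang2022.Section17NuOneStarTailSplit
import Literature.NumberTheory.LFunctions.Zhang2022.TypedSection17NuStarBound
import Literature.NumberTheory.LFunctions.Zhang2022.Section17U025WeightDefect
import Literature.NumberTheory.LFunctions.Zhang2022.Section8Ded823Assembly
import Literature.NumberTheory.LFunctions.MertensElementary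
import HarnessLib

/-!
# Zhang (2022) §17.u021 (χ-twisted reading), remainder `R₁` in RELATIVE currency: the PRIME WINDOW
# `m₂ = p`, `T² < 4D⁴p` — the `hLp`-window half of the `R1Rel` assembly, `≪ 𝓛^{−2.8}(𝔞+1)`

Topic `Literature/NumberTheory/LFunctions/Zhang2022` (Landau–Siegel audit tree; verdict-neutral).
Y. Zhang, *Discrete mean estimates and the Landau–Siegel zero*, arXiv:2211.02515v1 (2022)
[Zhang2022LandauSiegel] — **an unrefereed manuscript under adjudication; nothing here asserts or denies
its Theorems 1–2, and no claim about Landau–Siegel zeros is made.** ZHANG-L discharge lane, WP16, R1-χ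
sub-leaf under `Typed.Section17.Eq17_9RelE` (node text `R1Rel c'`, consumer edge
`Phi3Eval.eq17_9RelE_of_R1Rel`; owner zl-libB-p6 g2; cut M2L-p = window (this file) + bulk). §17 p. 98
(tex L4825): "we can drop the terms with `m₂ > 1` … with an acceptable error" — no bound in print; the
assembly `Phi3Eval.step17_u021Chi_R1Rel_of_split` (skeleton `Section17U021ChiR1Assembly`) splits the
normed remainder into small arguments / large composite / large prime; THIS FILE proves the large-prime
part on the `T²`-cutoff WINDOW `bigT D ^ 2 < 4·D⁴·m₂` (the complementary bulk `4·D⁴·p ≤ T²` is the other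
half of the cut), modulo the `𝔞`-currency square count `hA1c` (A1 line):

  `Σ_{l<D⁴} |ν(l)|/l Σ_{q₁q₂=l} Σ_{m₁} Σ_{p prime, D⁴<q₂p, (p,q₁)=1, T²<4D⁴p}
      |b(q₁m₁)|·|ν₁*(q₂p)|·|κ̄₂(m₁p)|/(m₁p) ≤ ε·(𝔞+1)`  eventually in `D`, under (A).

Mechanism (norms inside, as the interface demands — the signed `q`-first cancellation of
`Section17U021ChiR1WindowXi` is not needed in the relative currency): (i) `p > T²/(4D⁴) > D⁴`, so by
the exact shape `nuOneStar_mul_prime_eq` and `|ρ_j(c′)| ≤ 3` for `c′ ≤ D⁴`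
(`ρ_j = υ ∗ nN_{β_j}`; `υ ∗ n^{−β}` is MULTIPLICATIVE with local values `w − 1 − χ(p)` and
`u·(w−1)(w−χ(p))`, `w = p^{−β}`, hence `|υ ∗ n^{−β}| ≤ e^{2|β|log n} ≤ 2`; the `g*`-defect is
`≤ D⁸e^{−𝓛³⁰} ≤ 1`), **`|ν₁*(q₂p)| ≤ 6τ(q₂)`** and `ν₁*(q₂p) = 0` for `p ≥ 2T²`; (ii) the `m₁`-sum is
the landed `m1Sum_le` (`≤ C τ(q₁)|κ̄₂(p)|(p/φ(p))²`, `|κ̄₂(p)| ≤ |b₁|log p`); (iii) Chebyshev–Mertens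
`Σ_{p≤2T²} log p/p ≤ 2𝓛^{1.1} + log 8`; (iv) the outer count `hA1c` and `𝔞 ≤ 16e⁹𝓛⁴`
(`Skeleton.frakA_le_ell_pow_four'`) give `≪ 𝓛^{−9+2+1+4+0.2}(𝔞+1) → 0`. (A) enters only through
`hA1c`'s currency. Theorems only; no definitions; standard axioms.

## References

* Y. Zhang, arXiv:2211.02515v1 (2022), §17 p. 98 (u021), tex L4825; §2 (2.13), (2.31).
  [cite: Zhang2022LandauSiegel, §17 u021 p.98]
-/

noncomputable section

open Complex Real Finset
open scoped LSeries.notation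

namespace Literature.NumberTheory.LFunctions.Zhang2022.Typed.Section17

open Literature.NumberTheory.LFunctions.Zhang2022
open Literature.NumberTheory.LFunctions.Zhang2022.Skeleton
open Literature.NumberTheory.LFunctions.Zhang2022.MeanSquareMajorant (tau tau_two_apply)
open Literature.NumberTheory.LFunctions.Zhang2022.Phi3Eval (ups_one ups_prime_pow_succ ups_mul_of_coprime)

/-! ## §1. `υ ∗ n^{−β}` is multiplicative with small local values: `|(υ ∗ n^{−β})(n)| ≤ e^{2|β| log n}` -/

section UpsCpow

variable {D : ℕ} (χ : DirichletCharacter ℂ D) (β : ℂ)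

/-- The values of `υ` as an arithmetic function at prime powers: `1, −(1+χ(p)), χ(p), 0, 0, …`.
[cite: Zhang2022LandauSiegel, §3 p.6 (υ)] -/
private theorem toAF_ups_prime_pow {p : ℕ} (hp : p.Prime) (i : ℕ) :
    toArithmeticFunction (ups χ) (p ^ i) =
      if i = 0 then 1 else if i = 1 then -(1 + χ (p : ZMod D)) else if i = 2 then χ (p : ZMod D)
        else 0 := by
  have h0 : toArithmeticFunction (ups χ) (p ^ i) = ups χ (p ^ i) := by
    simp [toArithmeticFunction, hp.ne_zero]
  rw [h0]
  rcases i with _ | i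
  · simp [ups_one χ]
  · rw [ups_prime_pow_succ χ hp i]
    rcases i with _ | i
    · simp
    · rcases i with _ | i
      · simp
      · rw [if_neg (by omega), if_neg (by omega), if_neg (by omega), if_neg (by omega), if_neg (by omega)]

/-- The values of `n ↦ n^{−β}` as an arithmetic function at prime powers. [folklore] -/
private theorem toAF_cpow_prime_pow {p : ℕ} (hp : p.Prime) (i : ℕ) :
    toArithmeticFunction (fun m : ℕ => (m : ℂ) ^ (-β)) (p ^ i) = ((p ^ i : ℕ) : ℂ) ^ (-β) := by
  simp [toArithmeticFunction, hp.ne_zero]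

/-- `(p^{i+1})^{−β} = p^{−β}·(p^i)^{−β}`. [folklore] -/
private theorem cpow_prime_pow_succ (p i : ℕ) :
    ((p ^ (i + 1) : ℕ) : ℂ) ^ (-β) = (p : ℂ) ^ (-β) * ((p ^ i : ℕ) : ℂ) ^ (-β) := by
  rw [pow_succ', Nat.cast_mul, Complex.natCast_mul_natCast_cpow, Nat.cast_pow]

/-- **`(υ ∗ n^{−β})(p) = p^{−β} − 1 − χ(p)`** at a prime. [cite: Zhang2022LandauSiegel, §17 u021 p.98] -/
theorem ups_conv_cpow_prime {p : ℕ} (hp : p.Prime) :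
    (ups χ ⍟ fun m : ℕ => (m : ℂ) ^ (-β)) p = (p : ℂ) ^ (-β) - 1 - χ (p : ZMod D) := by
  have h : (ups χ ⍟ fun m : ℕ => (m : ℂ) ^ (-β)) p =
      (toArithmeticFunction (ups χ) * toArithmeticFunction (fun m : ℕ => (m : ℂ) ^ (-β))) (p ^ 1) := by
    rw [pow_one]; rfl
  rw [h, RankinEisenstein.mul_apply_prime_pow _ _ hp, Finset.sum_range_succ, Finset.sum_range_succ,
    Finset.sum_range_zero, zero_add, toAF_ups_prime_pow χ hp, toAF_ups_prime_pow χ hp,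
    toAF_cpow_prime_pow β hp, toAF_cpow_prime_pow β hp]
  simp only [if_true, one_ne_zero, if_false, Nat.sub_zero, Nat.sub_self, pow_zero, pow_one,
    Nat.cast_one, Complex.one_cpow]
  ring

/-- **`(υ ∗ n^{−β})(p^{j+2}) = (p^j)^{−β}·(p^{−β} − 1)(p^{−β} − χ(p))`** at higher prime powers (the
local factor of `υ` is `1 − (1+χ(p))x + χ(p)x²`). [cite: Zhang2022LandauSiegel, §17 u021 p.98] -/
theorem ups_conv_cpow_prime_pow_add_two {p : ℕ} (hp : p.Prime) (j : ℕ) :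
    (ups χ ⍟ fun m : ℕ => (m : ℂ) ^ (-β)) (p ^ (j + 2)) =
      ((p ^ j : ℕ) : ℂ) ^ (-β) * (((p : ℂ) ^ (-β) - 1) * ((p : ℂ) ^ (-β) - χ (p : ZMod D))) := by
  have h : (ups χ ⍟ fun m : ℕ => (m : ℂ) ^ (-β)) (p ^ (j + 2)) =
      (toArithmeticFunction (ups χ) * toArithmeticFunction (fun m : ℕ => (m : ℂ) ^ (-β)))
        (p ^ (j + 2)) := rfl
  rw [h, RankinEisenstein.mul_apply_prime_pow _ _ hp]
  -- peel `i = 0, 1, 2`; the rest vanishes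
  rw [Finset.sum_range_succ', Finset.sum_range_succ', Finset.sum_range_succ']
  have hrest : ∑ i ∈ Finset.range j, toArithmeticFunction (ups χ) (p ^ (i + 1 + 1 + 1)) *
      toArithmeticFunction (fun m : ℕ => (m : ℂ) ^ (-β)) (p ^ (j + 2 - (i + 1 + 1 + 1))) = 0 := by
    refine Finset.sum_eq_zero fun i _ => ?_
    rw [toAF_ups_prime_pow χ hp, if_neg (by omega), if_neg (by omega), if_neg (by omega), zero_mul]
  rw [hrest, zero_add, toAF_ups_prime_pow χ hp, toAF_ups_prime_pow χ hp, toAF_ups_prime_pow χ hp,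
    toAF_cpow_prime_pow β hp, toAF_cpow_prime_pow β hp, toAF_cpow_prime_pow β hp]
  simp only [show (0 : ℕ) + 1 + 1 = 2 from rfl, show (0 : ℕ) + 1 = 1 from rfl, if_true, one_ne_zero,
    if_false, show (2 : ℕ) ≠ 0 from by norm_num, show (2 : ℕ) ≠ 1 from by norm_num, Nat.sub_zero,
    show j + 2 - 1 = j + 1 from by omega, show j + 2 - 2 = j from by omega]
  rw [show j + 2 = (j + 1) + 1 from rfl, cpow_prime_pow_succ β p (j + 1), cpow_prime_pow_succ β p j]
  ring

/-- **Local bound**: `‖(υ ∗ n^{−β})(p^{k+1})‖ ≤ 1 + 2|β|log p` for `Re β = 0` (`|p^{−β}| = 1`,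
`|p^{−β} − 1| ≤ |β|log p`, `|χ(p)| ≤ 1`). [cite: Zhang2022LandauSiegel, §17 u021 p.98] -/
theorem norm_ups_conv_cpow_prime_pow_le (hβ : β.re = 0) {p : ℕ} (hp : p.Prime) (k : ℕ) :
    ‖(ups χ ⍟ fun m : ℕ => (m : ℂ) ^ (-β)) (p ^ (k + 1))‖ ≤ 1 + 2 * (‖β‖ * Real.log p) := by
  have hw := norm_natCast_cpow_neg_sub_one_le hβ hp.one_lt.le
  have hχ : ‖χ (p : ZMod D)‖ ≤ 1 := DirichletCharacter.norm_le_one χ _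
  have hlog0 : 0 ≤ ‖β‖ * Real.log p := mul_nonneg (norm_nonneg _) (Real.log_natCast_nonneg p)
  have hw1 : ‖(p : ℂ) ^ (-β)‖ = 1 := by
    rw [Complex.norm_natCast_cpow_of_pos hp.pos]; simp [hβ]
  rcases k with _ | k
  · rw [pow_one, ups_conv_cpow_prime χ β hp]
    calc ‖(p : ℂ) ^ (-β) - 1 - χ (p : ZMod D)‖ ≤ ‖(p : ℂ) ^ (-β) - 1‖ + ‖χ (p : ZMod D)‖ :=
          norm_sub_le _ _
      _ ≤ ‖β‖ * Real.log p + 1 := add_le_add hw hχ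
      _ ≤ 1 + 2 * (‖β‖ * Real.log p) := by linarith
  · rw [show k + 1 + 1 = k + 2 from rfl, ups_conv_cpow_prime_pow_add_two χ β hp k, norm_mul, norm_mul]
    have hu : ‖((p ^ k : ℕ) : ℂ) ^ (-β)‖ = 1 := by
      rw [Complex.norm_natCast_cpow_of_pos (pow_pos hp.pos k)]; simp [hβ]
    have h2 : ‖(p : ℂ) ^ (-β) - χ (p : ZMod D)‖ ≤ 2 := by
      calc ‖(p : ℂ) ^ (-β) - χ (p : ZMod D)‖ ≤ ‖(p : ℂ) ^ (-β)‖ + ‖χ (p : ZMod D)‖ := norm_sub_le _ _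
        _ ≤ 1 + 1 := by rw [hw1]; exact add_le_add le_rfl hχ
        _ = 2 := by norm_num
    rw [hu, one_mul]
    calc ‖(p : ℂ) ^ (-β) - 1‖ * ‖(p : ℂ) ^ (-β) - χ (p : ZMod D)‖ ≤ (‖β‖ * Real.log p) * 2 :=
          mul_le_mul hw h2 (norm_nonneg _) hlog0
      _ ≤ 1 + 2 * (‖β‖ * Real.log p) := by linarith

/-- **`|(υ ∗ n^{−β})(n)| ≤ exp(2|β|·log n)`** for `Re β = 0`, `n ≥ 1`: multiplicativity (`υ = μ∗μχ`,
`n^{−β}` completely multiplicative), the local bound `1 + 2|β|log p ≤ e^{2|β|log p}`, and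
`Σ_{p∣n} log p ≤ log n`. [cite: Zhang2022LandauSiegel, §17 u021 p.98; §3 p.6 (υ)] -/
theorem norm_ups_conv_cpow_le (hβ : β.re = 0) {n : ℕ} (hn : n ≠ 0) :
    ‖(ups χ ⍟ fun m : ℕ => (m : ℂ) ^ (-β)) n‖ ≤ Real.exp (2 * ‖β‖ * Real.log n) := by
  classical
  set f : ℕ → ℂ := fun m : ℕ => (m : ℂ) ^ (-β) with hf
  have hU : (toArithmeticFunction (ups χ)).IsMultiplicative := by
    rw [ArithmeticFunction.IsMultiplicative.iff_ne_zero]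
    refine ⟨by simp [toArithmeticFunction, ups_one χ], fun {a b} ha hb hab => ?_⟩
    simp [toArithmeticFunction, ha, hb, mul_ne_zero ha hb, ups_mul_of_coprime χ ha hb hab]
  have hF : (toArithmeticFunction f).IsMultiplicative := by
    rw [ArithmeticFunction.IsMultiplicative.iff_ne_zero]
    refine ⟨by simp [toArithmeticFunction, hf], fun {a b} ha hb _ => ?_⟩
    simp [toArithmeticFunction, ha, hb, mul_ne_zero ha hb, hf, Nat.cast_mul,
      Complex.natCast_mul_natCast_cpow]
  set P : ArithmeticFunction ℂ := toArithmeticFunction (ups χ) * toArithmeticFunction f with hP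
  have hPm : P.IsMultiplicative := hU.mul hF
  have hconv : (ups χ ⍟ f) n = P n := rfl
  rw [hconv, ArithmeticFunction.IsMultiplicative.multiplicative_factorization P hPm hn,
    Nat.prod_factorization_eq_prod_primeFactors, norm_prod]
  -- each local factor
  have hfac : ∀ p ∈ n.primeFactors, ‖P (p ^ n.factorization p)‖ ≤ Real.exp (2 * ‖β‖ * Real.log p) := by
    intro p hp
    have hpp : p.Prime := Nat.prime_of_mem_primeFactors hp
    obtain ⟨k, hk⟩ : ∃ k, n.factorization p = k + 1 :=
      ⟨n.factorization p - 1, by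
        have := Nat.Prime.factorization_pos_of_dvd hpp hn (Nat.dvd_of_mem_primeFactors hp); omega⟩
    rw [hk]
    have h := norm_ups_conv_cpow_prime_pow_le χ β hβ hpp k
    have e : (ups χ ⍟ fun m : ℕ => (m : ℂ) ^ (-β)) (p ^ (k + 1)) = P (p ^ (k + 1)) := rfl
    rw [e] at h
    refine h.trans ?_
    have := Real.add_one_le_exp (2 * (‖β‖ * Real.log p))
    rw [show 2 * ‖β‖ * Real.log p = 2 * (‖β‖ * Real.log p) by ring]
    linarith
  refine (Finset.prod_le_prod (fun p _ => norm_nonneg _) hfac).trans ?_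
  rw [← Real.exp_sum, Real.exp_le_exp, ← Finset.mul_sum]
  refine mul_le_mul_of_nonneg_left ?_ (by positivity)
  -- `Σ_{p∣n} log p = log(∏_{p∣n} p) ≤ log n`
  have hprod : (∏ p ∈ n.primeFactors, (p : ℝ)) ≤ n := by
    have hdvd : (∏ p ∈ n.primeFactors, p) ∣ n := Nat.prod_primeFactors_dvd n
    have h := Nat.le_of_dvd (Nat.pos_of_ne_zero hn) hdvd
    have e : (∏ p ∈ n.primeFactors, (p : ℝ)) = ((∏ p ∈ n.primeFactors, p : ℕ) : ℝ) := by push_cast; rfl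
    rw [e]; exact_mod_cast h
  have hpos : ∀ p ∈ n.primeFactors, (0 : ℝ) < p := fun p hp =>
    by exact_mod_cast (Nat.prime_of_mem_primeFactors hp).pos
  have hlp : Real.log (∏ p ∈ n.primeFactors, (p : ℝ)) = ∑ p ∈ n.primeFactors, Real.log (p : ℝ) :=
    Real.log_prod (fun p hp => (hpos p hp).ne')
  rw [← hlp]
  exact Real.log_le_log (Finset.prod_pos hpos) hprod

end UpsCpow

/-! ## §2. `|ρ_j(n)| ≤ 3` on `n ≤ D⁴` and `|ν₁*(q₂p)| ≤ 6τ(q₂)` for a prime `p > D⁴` -/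

section Rho

variable {D : ℕ} (χ : DirichletCharacter ℂ D)

/-- **`|(υ ∗ nN_β)(n)| ≤ 3`** for `1 ≤ n ≤ D⁴`, `Re β = 0`, `|β| ≤ 10α`, once `𝓛 ≥ 3` and `eD⁴ ≤ T²`:
the multiplicative model `υ ∗ n^{−β}` is `≤ e^{80α𝓛} ≤ 2` (`norm_ups_conv_cpow_le`), and the
`g*`-defect `Σ_{ab=n}|υ(a)|·|g*(T²/b) − 1|` is `≤ n²·½e^{−𝓛³⁰} ≤ 1` ((4.2), `T²/b ≥ e`).
[cite: Zhang2022LandauSiegel, §17 u021 p.98; §4 (4.2)] -/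
theorem norm_ups_conv_nN_le_three (hℓ : 3 ≤ ell D) (hD1 : 1 ≤ D)
    (hT : Real.exp 1 * (D : ℝ) ^ 4 ≤ bigT D ^ 2) {β : ℂ} (hβ : β.re = 0)
    (hβ10 : ‖β‖ ≤ 10 * alpha D) {n : ℕ} (hn1 : 1 ≤ n) (hnD : (n : ℝ) ≤ (D : ℝ) ^ 4) :
    ‖(ups χ ⍟ nN D β) n‖ ≤ 3 := by
  classical
  have hn0 : n ≠ 0 := by omega
  have hℓ0 : 0 < ell D := by linarith
  have hℓ1 : 1 ≤ ell D := by linarith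
  have hΛ : (0 : ℝ) < ell D ^ 30 := pow_pos hℓ0 30
  have hT0 : 0 < bigT D := Real.exp_pos _
  have hDexp : (D : ℝ) = Real.exp (ell D) := by
    rw [ell, Real.exp_log (by exact_mod_cast hD1)]
  -- the two pieces
  set f : ℕ → ℂ := fun m : ℕ => (m : ℂ) ^ (-β) with hf
  have hsplit : (ups χ ⍟ nN D β) n = (ups χ ⍟ f) n +
      ∑ x ∈ n.divisorsAntidiagonal, ups χ x.1 * (f x.2 * ((gstar D (bigT D ^ 2 / x.2) : ℂ) - 1)) := by
    rw [congrFun (LSeries.convolution_def (ups χ) (nN D β)) n,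
      congrFun (LSeries.convolution_def (ups χ) f) n]
    simp only [← Finset.sum_add_distrib]
    refine Finset.sum_congr rfl fun x _ => ?_
    simp only [nN, hf]
    ring
  -- main part `≤ 2`
  have hmain : ‖(ups χ ⍟ f) n‖ ≤ 2 := by
    refine (norm_ups_conv_cpow_le χ β hβ hn0).trans ?_
    have hlogn : Real.log n ≤ 4 * ell D := by
      have h := Real.log_le_log (by exact_mod_cast hn1 : (0 : ℝ) < n) hnD
      rw [Real.log_pow] at h
      simpa [ell] using h
    have hα : alpha D = π / ell D ^ 9 := by rw [alpha, bigP, Real.log_exp]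
    have h80 : 2 * ‖β‖ * Real.log n ≤ Real.log 2 := by
      have hl0 : 0 ≤ Real.log n := Real.log_natCast_nonneg n
      have hα0 : 0 ≤ alpha D := by rw [hα]; positivity
      calc 2 * ‖β‖ * Real.log n ≤ 2 * (10 * alpha D) * (4 * ell D) := by
            gcongr
        _ = 80 * π / ell D ^ 8 := by
            rw [hα]; field_simp; ring
        _ ≤ 80 * π / 3 ^ 8 := by
            gcongr
        _ ≤ Real.log 2 := by
            have := Real.log_two_gt_d9; have := Real.pi_lt_four; norm_num at *; nlinarith
    calc Real.exp (2 * ‖β‖ * Real.log n) ≤ Real.exp (Real.log 2) := Real.exp_le_exp.mpr h80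
      _ = 2 := Real.exp_log (by norm_num)
  -- defect part `≤ 1`
  have hdef : ‖∑ x ∈ n.divisorsAntidiagonal,
      ups χ x.1 * (f x.2 * ((gstar D (bigT D ^ 2 / x.2) : ℂ) - 1))‖ ≤ 1 := by
    have hterm : ∀ x ∈ n.divisorsAntidiagonal,
        ‖ups χ x.1 * (f x.2 * ((gstar D (bigT D ^ 2 / x.2) : ℂ) - 1))‖ ≤
          (n : ℝ) * ((1 / 2) * Real.exp (-(ell D ^ 30))) := by
      intro x hx
      have hx' := Nat.mem_divisorsAntidiagonal.mp hx
      have hx1 : x.1 ≠ 0 := left_ne_zero_of_mul (hx'.1 ▸ hx'.2)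
      have hx2 : x.2 ≠ 0 := right_ne_zero_of_mul (hx'.1 ▸ hx'.2)
      have hx2pos : (0 : ℝ) < x.2 := by exact_mod_cast Nat.pos_of_ne_zero hx2
      -- `‖υ(a)‖ ≤ τ₂(a) ≤ a ≤ n`
      have hups : ‖ups χ x.1‖ ≤ n := by
        refine (Lemma34.norm_ups_le χ x.1).trans ?_
        rw [tau_two_apply]
        have h1 : (x.1.divisors.card : ℝ) ≤ x.1 := by exact_mod_cast Nat.card_divisors_le_self x.1
        have h2 : (x.1 : ℝ) ≤ n := by
          exact_mod_cast Nat.le_of_dvd (Nat.pos_of_ne_zero hn0) (Nat.fst_mem_divisors_of_mem_antidiagonal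
            hx |> Nat.dvd_of_mem_divisors)
        exact h1.trans h2
      -- `‖f(b)‖ = 1`
      have hfb : ‖f x.2‖ = 1 := by
        rw [hf]; dsimp only
        rw [Complex.norm_natCast_cpow_of_pos (Nat.pos_of_ne_zero hx2)]; simp [hβ]
      -- `|g*(T²/b) − 1| ≤ ½ e^{−𝓛³⁰}`
      have hx2D : (x.2 : ℝ) ≤ (D : ℝ) ^ 4 := by
        have : (x.2 : ℝ) ≤ n := by
          exact_mod_cast Nat.le_of_dvd (Nat.pos_of_ne_zero hn0) (Nat.snd_mem_divisors_of_mem_antidiagonal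
            hx |> Nat.dvd_of_mem_divisors)
        exact this.trans hnD
      have hy : Real.exp 1 ≤ bigT D ^ 2 / x.2 := by
        rw [le_div_iff₀ hx2pos]
        calc Real.exp 1 * x.2 ≤ Real.exp 1 * (D : ℝ) ^ 4 := by gcongr
          _ ≤ bigT D ^ 2 := hT
      have hy1 : 1 ≤ bigT D ^ 2 / x.2 := le_trans (by have := Real.add_one_le_exp (1:ℝ); linarith) hy
      have hg : ‖((gstar D (bigT D ^ 2 / x.2) : ℂ) - 1)‖ ≤ (1 / 2) * Real.exp (-(ell D ^ 30)) := by
        rw [← Complex.ofReal_one, ← Complex.ofReal_sub, Complex.norm_real, Real.norm_eq_abs,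
          gstar, if_pos (by linarith), gW]
        refine (GaussWeight.abs_gWeight_sub_one_le hΛ hy1).trans ?_
        gcongr (1 / 2) * Real.exp ?_
        have hlog : 1 ≤ Real.log (bigT D ^ 2 / x.2) := by
          rw [← Real.log_exp 1]; exact Real.log_le_log (Real.exp_pos 1) hy
        nlinarith [hΛ, mul_self_le_mul_self zero_le_one hlog]
      rw [norm_mul, norm_mul, hfb, one_mul]
      exact mul_le_mul hups hg (norm_nonneg _) (Nat.cast_nonneg n)
    refine (norm_sum_le _ _).trans ((Finset.sum_le_sum hterm).trans ?_)
    rw [Finset.sum_const, nsmul_eq_mul]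
    have hcard : ((n.divisorsAntidiagonal).card : ℝ) ≤ n := by
      rw [← Nat.map_div_right_divisors, Finset.card_map]; exact_mod_cast Nat.card_divisors_le_self n
    -- `n·n·½e^{−𝓛³⁰} ≤ D⁸·½e^{−𝓛³⁰} ≤ 1`
    have hnD' : (n : ℝ) ≤ Real.exp (4 * ell D) := by
      rw [show (4 : ℝ) * ell D = ↑(4 : ℕ) * ell D by norm_num, Real.exp_nat_mul, ← hDexp]; exact hnD
    have hexp : Real.exp (4 * ell D) * Real.exp (4 * ell D) * Real.exp (-(ell D ^ 30)) ≤ 1 := by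
      rw [← Real.exp_add, ← Real.exp_add, Real.exp_le_one_iff]
      have : ell D * 8 ≤ ell D ^ 30 := by
        calc ell D * 8 ≤ ell D * ell D ^ 29 := by
              refine mul_le_mul_of_nonneg_left ?_ hℓ0.le
              calc (8 : ℝ) ≤ 3 ^ 29 := by norm_num
                _ ≤ ell D ^ 29 := pow_le_pow_left₀ (by norm_num) hℓ 29
          _ = ell D ^ 30 := by ring
      linarith
    have hn0' : (0 : ℝ) ≤ n := Nat.cast_nonneg n
    calc ((n.divisorsAntidiagonal).card : ℝ) * ((n : ℝ) * ((1 / 2) * Real.exp (-(ell D ^ 30))))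
        ≤ (n : ℝ) * ((n : ℝ) * ((1 / 2) * Real.exp (-(ell D ^ 30)))) := by
          gcongr
      _ ≤ Real.exp (4 * ell D) * (Real.exp (4 * ell D) * ((1 / 2) * Real.exp (-(ell D ^ 30)))) := by
          gcongr
      _ = (1 / 2) * (Real.exp (4 * ell D) * Real.exp (4 * ell D) * Real.exp (-(ell D ^ 30))) := by
          ring
      _ ≤ (1 / 2) * 1 := by gcongr
      _ ≤ 1 := by norm_num
  rw [hsplit]
  calc _ ≤ ‖(ups χ ⍟ f) n‖ + ‖∑ x ∈ n.divisorsAntidiagonal,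
        ups χ x.1 * (f x.2 * ((gstar D (bigT D ^ 2 / x.2) : ℂ) - 1))‖ := norm_add_le _ _
    _ ≤ 2 + 1 := add_le_add hmain hdef
    _ = 3 := by norm_num

/-- `nN_β(b) = 0` for `b ≥ 2T²` (`g*(T²/b) = 0` as `T²/b ≤ ½`). [cite: Zhang2022LandauSiegel, §6 p.30 (g*)] -/
theorem nN_eq_zero_of_two_mul_le (β : ℂ) {b : ℕ} (hb : 2 * bigT D ^ 2 ≤ (b : ℝ)) : nN D β b = 0 := by
  have hT0 : 0 < bigT D := Real.exp_pos _
  have hb0 : (0 : ℝ) < b := lt_of_lt_of_le (by positivity) hb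
  have h : ¬ (1 / 2 : ℝ) < bigT D ^ 2 / b := by
    rw [not_lt, div_le_iff₀ hb0]; linarith
  rw [nN, gstar, if_neg h, Complex.ofReal_zero, mul_zero]

/-- **`|ν₁*(q₂p)| ≤ 6·τ(q₂)`** for a prime `p > D⁴` and `1 ≤ q₂ ≤ D⁴` (under the size hypotheses of
`norm_ups_conv_nN_le_three`): by the exact shape `nuOneStar_mul_prime_eq`, `|nN| ≤ 1` and `|ρ_j| ≤ 3`.
[cite: Zhang2022LandauSiegel, §17 u021 p.98] -/
theorem norm_nuOneStar_mul_prime_le (c' : ℝ) (hℓ : 3 ≤ ell D) (hD1 : 1 ≤ D)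
    (hT : Real.exp 1 * (D : ℝ) ^ 4 ≤ bigT D ^ 2)
    (hβ2 : ‖beta2 c' D‖ ≤ 10 * alpha D) (hβ3 : ‖beta3 c' D‖ ≤ 10 * alpha D)
    {p : ℕ} (hp : p.Prime) (hpD : D ^ 4 < p) {q₂ : ℕ} (hq1 : 1 ≤ q₂) (hq : q₂ ≤ D ^ 4) :
    ‖nuOneStar c' χ (q₂ * p)‖ ≤ 6 * (q₂.divisors.card : ℝ) := by
  classical
  have hℓ0 : 0 < ell D := by linarith
  have hq0 : q₂ ≠ 0 := by omega
  have hre2 : (beta2 c' D).re = 0 := by simp [beta2]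
  have hre3 : (beta3 c' D).re = 0 := by simp [beta3]
  rw [nuOneStar_mul_prime_eq c' χ hp hpD hq hq0]
  have hdiv : ∀ y ∈ q₂.divisorsAntidiagonal, 1 ≤ y.2 ∧ (y.2 : ℝ) ≤ (D : ℝ) ^ 4 := by
    intro y hy
    have hy' := Nat.mem_divisorsAntidiagonal.mp hy
    have hy2 : y.2 ≠ 0 := right_ne_zero_of_mul (hy'.1 ▸ hy'.2)
    refine ⟨Nat.one_le_iff_ne_zero.mpr hy2, ?_⟩
    have : y.2 ≤ q₂ := Nat.le_of_dvd (Nat.pos_of_ne_zero hq0)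
      (Nat.snd_mem_divisors_of_mem_antidiagonal hy |> Nat.dvd_of_mem_divisors)
    exact_mod_cast this.trans hq
  have hA : ∀ y ∈ q₂.divisorsAntidiagonal,
      ‖nN D (beta2 c' D) (p * y.1) * (ups χ ⍟ nN D (beta3 c' D)) y.2‖ ≤ 3 := by
    intro y hy
    obtain ⟨h1, h2⟩ := hdiv y hy
    rw [norm_mul]
    calc _ ≤ 1 * 3 := mul_le_mul (Phi3TermByTerm.norm_nN_le_one hℓ0 hre2 _)
          (norm_ups_conv_nN_le_three χ hℓ hD1 hT hre3 hβ3 h1 h2) (norm_nonneg _) zero_le_one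
      _ = 3 := one_mul _
  have hB : ∀ y ∈ q₂.divisorsAntidiagonal,
      ‖nN D (beta3 c' D) (p * y.1) * (ups χ ⍟ nN D (beta2 c' D)) y.2‖ ≤ 3 := by
    intro y hy
    obtain ⟨h1, h2⟩ := hdiv y hy
    rw [norm_mul]
    calc _ ≤ 1 * 3 := mul_le_mul (Phi3TermByTerm.norm_nN_le_one hℓ0 hre3 _)
          (norm_ups_conv_nN_le_three χ hℓ hD1 hT hre2 hβ2 h1 h2) (norm_nonneg _) zero_le_one
      _ = 3 := one_mul _
  have hcard : ((q₂.divisorsAntidiagonal).card : ℝ) = q₂.divisors.card := by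
    rw [← Nat.map_div_right_divisors, Finset.card_map]
  calc _ ≤ ‖∑ y ∈ q₂.divisorsAntidiagonal, nN D (beta2 c' D) (p * y.1) * (ups χ ⍟ nN D (beta3 c' D)) y.2‖ +
        ‖∑ y ∈ q₂.divisorsAntidiagonal, nN D (beta3 c' D) (p * y.1) * (ups χ ⍟ nN D (beta2 c' D)) y.2‖ :=
        norm_add_le _ _
    _ ≤ (∑ y ∈ q₂.divisorsAntidiagonal, (3 : ℝ)) + ∑ y ∈ q₂.divisorsAntidiagonal, (3 : ℝ) :=
        add_le_add ((norm_sum_le _ _).trans (Finset.sum_le_sum hA))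
          ((norm_sum_le _ _).trans (Finset.sum_le_sum hB))
    _ = 6 * (q₂.divisors.card : ℝ) := by rw [Finset.sum_const, nsmul_eq_mul, hcard]; ring

/-- `ν₁*(q₂p) = 0` for a prime `p ≥ 2T²` (`> D⁴`) and `1 ≤ q₂ ≤ D⁴`: every `nN(p·b′)` vanishes.
[cite: Zhang2022LandauSiegel, §17 u021 p.98] -/
theorem nuOneStar_mul_prime_eq_zero (c' : ℝ) {p : ℕ} (hp : p.Prime) (hpD : D ^ 4 < p)
    (hpT : 2 * bigT D ^ 2 ≤ (p : ℝ)) {q₂ : ℕ} (hq1 : 1 ≤ q₂) (hq : q₂ ≤ D ^ 4) :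
    nuOneStar c' χ (q₂ * p) = 0 := by
  classical
  have hq0 : q₂ ≠ 0 := by omega
  rw [nuOneStar_mul_prime_eq c' χ hp hpD hq hq0]
  have hz : ∀ (β : ℂ), ∀ y ∈ q₂.divisorsAntidiagonal, nN D β (p * y.1) = 0 := by
    intro β y hy
    have hy' := Nat.mem_divisorsAntidiagonal.mp hy
    have hy1 : y.1 ≠ 0 := left_ne_zero_of_mul (hy'.1 ▸ hy'.2)
    apply nN_eq_zero_of_two_mul_le
    have : (p : ℝ) ≤ ((p * y.1 : ℕ) : ℝ) := by
      exact_mod_cast Nat.le_mul_of_pos_right p (Nat.pos_of_ne_zero hy1)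
    exact hpT.trans this
  rw [Finset.sum_eq_zero (fun y hy => by rw [hz _ y hy, zero_mul]),
    Finset.sum_eq_zero (fun y hy => by rw [hz _ y hy, zero_mul]), add_zero]

end Rho

/-! ## §3. Supports, finite double sums, thresholds -/

section Support

variable {D : ℕ} (χ : DirichletCharacter ℂ D) (c' : ℝ)

/-- A common index beyond which the `m₁`- and `m₂`-summands of `R₁` vanish (`b(q₁m₁) = 0`,
`ν₁*(q₂m₂) = 0` for `m₁, m₂ ≥ N`, `q₁, q₂ ≥ 1`) — as in `Section17U021ChiR1Assembly.exists_R1_support`,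
re-proved here to keep the assembly file downstream. [cite: Zhang2022LandauSiegel, §15 (15.2); §17 p.98] -/
theorem exists_R1_support_window :
    ∃ N : ℕ, (∀ q₁ m : ℕ, 1 ≤ q₁ → N ≤ m → bcoef D (q₁ * m) = 0) ∧
      (∀ q₂ m : ℕ, 1 ≤ q₂ → N ≤ m → nuOneStar c' χ (q₂ * m) = 0) := by
  refine ⟨max ⌈bigP D ^ (1 / 2 : ℝ) * max (Skeleton.P2 D) (Skeleton.P3 D)⌉₊
    ⌈4 * ((D : ℝ) ^ 4 + 1) * bigT D ^ 4⌉₊, fun q₁ m hq hm => ?_, fun q₂ m hq hm => ?_⟩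
  · apply bcoef_eq_zero_of_sqrtP_mul_max_le
    have h1 : (⌈bigP D ^ (1 / 2 : ℝ) * max (Skeleton.P2 D) (Skeleton.P3 D)⌉₊ : ℝ) ≤ m := by
      exact_mod_cast le_trans (le_max_left _ _) hm
    have h2 : (m : ℝ) ≤ ((q₁ * m : ℕ) : ℝ) := by
      exact_mod_cast Nat.le_mul_of_pos_left m hq
    exact le_trans (le_trans (Nat.le_ceil _) h1) h2
  · apply nuOneStar_eq_zero_of_le
    have h1 : (⌈4 * ((D : ℝ) ^ 4 + 1) * bigT D ^ 4⌉₊ : ℝ) ≤ m := by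
      exact_mod_cast le_trans (le_max_right _ _) hm
    have h2 : (m : ℝ) ≤ ((q₂ * m : ℕ) : ℝ) := by
      exact_mod_cast Nat.le_mul_of_pos_left m hq
    exact le_trans (le_trans (Nat.le_ceil _) h1) h2

end Support

/-- A double series of reals whose terms vanish once either index is `≥ N` is the finite double sum
over `range N × range N`. [folklore] -/
private theorem tsum_tsum_eq_sum_sum_of_vanish' (F : ℕ → ℕ → ℝ) (N : ℕ)
    (h₁ : ∀ m₁ m₂, N ≤ m₁ → F m₁ m₂ = 0) (h₂ : ∀ m₁ m₂, N ≤ m₂ → F m₁ m₂ = 0) :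
    (∑' m₁ : ℕ, ∑' m₂ : ℕ, F m₁ m₂) = ∑ m₁ ∈ Finset.range N, ∑ m₂ ∈ Finset.range N, F m₁ m₂ := by
  have hin : ∀ m₁, (∑' m₂ : ℕ, F m₁ m₂) = ∑ m₂ ∈ Finset.range N, F m₁ m₂ := by
    intro m₁
    refine tsum_eq_sum fun m₂ hm₂ => h₂ m₁ m₂ ?_
    simpa using hm₂
  rw [tsum_congr hin]
  refine tsum_eq_sum fun m₁ hm₁ => ?_
  have hN : N ≤ m₁ := by simpa using hm₁
  exact Finset.sum_eq_zero fun m₂ _ => h₁ m₁ m₂ hN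

/-- **`4D⁸ ≤ T²` eventually** (`T = e^{𝓛^{1.1}}`, `D⁸ = e^{8𝓛}`; `𝓛^{0.1} ≥ 5` once `𝓛 ≥ 5¹⁰`).
[cite: Zhang2022LandauSiegel, §6 p.28 (`T`)] -/
theorem four_mul_pow_eight_le_bigT_sq : ∃ D₀ : ℕ, ∀ D : ℕ, D₀ ≤ D → 4 * (D : ℝ) ^ 8 ≤ bigT D ^ 2 := by
  refine ⟨max 2 ⌈Real.exp ((5 : ℝ) ^ (10 : ℕ))⌉₊, fun D hD => ?_⟩
  have hD2 : 2 ≤ D := le_trans (le_max_left _ _) hD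
  have hD1 : (1 : ℝ) ≤ D := by exact_mod_cast le_trans one_le_two hD2
  have hℓ : (5 : ℝ) ^ (10 : ℕ) ≤ ell D := by
    have h1 : Real.exp ((5 : ℝ) ^ (10 : ℕ)) ≤ D :=
      (Nat.le_ceil _).trans (by exact_mod_cast le_trans (le_max_right _ _) hD)
    calc (5 : ℝ) ^ (10 : ℕ) = Real.log (Real.exp ((5 : ℝ) ^ (10 : ℕ))) := (Real.log_exp _).symm
      _ ≤ Real.log D := Real.log_le_log (Real.exp_pos _) h1
      _ = ell D := rfl
  have hℓ0 : 0 < ell D := lt_of_lt_of_le (by positivity) hℓ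
  have hDexp : (D : ℝ) = Real.exp (ell D) := by rw [ell, Real.exp_log (by linarith)]
  -- `𝓛^{0.1} ≥ 5`
  have h01 : (5 : ℝ) ≤ ell D ^ (0.1 : ℝ) := by
    have h5 : (5 : ℝ) = ((5 : ℝ) ^ (10 : ℕ)) ^ (0.1 : ℝ) := by
      rw [← Real.rpow_natCast, ← Real.rpow_mul (by norm_num)]; norm_num
    rw [h5]
    exact Real.rpow_le_rpow (by positivity) hℓ (by norm_num)
  have h11 : 5 * ell D ≤ ell D ^ (1.1 : ℝ) := by
    rw [show (1.1 : ℝ) = 1 + 0.1 by norm_num, Real.rpow_add hℓ0, Real.rpow_one]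
    exact mul_comm (5 : ℝ) (ell D) ▸ mul_le_mul_of_nonneg_left h01 hℓ0.le
  -- `4D⁸ ≤ D¹⁰ = e^{10𝓛} ≤ e^{2𝓛^{1.1}} = T²`
  have hD4 : (4 : ℝ) ≤ (D : ℝ) ^ 2 := by
    have : (2 : ℝ) ≤ D := by exact_mod_cast hD2
    nlinarith
  calc 4 * (D : ℝ) ^ 8 ≤ (D : ℝ) ^ 2 * (D : ℝ) ^ 8 := by gcongr
    _ = Real.exp (10 * ell D) := by
        rw [← pow_add, hDexp, ← Real.exp_nat_mul]; norm_num
    _ ≤ Real.exp (2 * ell D ^ (1.1 : ℝ)) := Real.exp_le_exp.mpr (by linarith)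
    _ = bigT D ^ 2 := by rw [bigT, ← Real.exp_nat_mul]; norm_num

/-! ## §4. The window piece of `R1Rel` -/

/-- `|β₂|, |β₃| ≤ 10α` once `|c′|·α𝓛 ≤ 1` (`β₂ = 2iα(1+c′α𝓛)`, `β₃ = 3iα(1−c′α𝓛)`).
[cite: Zhang2022LandauSiegel, §2 (2.13)] -/
theorem norm_beta23_le (c' : ℝ) {D : ℕ} (hα0 : 0 ≤ alpha D) (hc : |c'| * (alpha D * ell D) ≤ 1) :
    ‖beta2 c' D‖ ≤ 10 * alpha D ∧ ‖beta3 c' D‖ ≤ 10 * alpha D := by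
  have hαℓ : 0 ≤ alpha D * ell D := mul_nonneg hα0 (show (0 : ℝ) ≤ ell D from Real.log_natCast_nonneg D)
  have habs : |c' * alpha D * ell D| = |c'| * (alpha D * ell D) := by
    rw [show c' * alpha D * ell D = c' * (alpha D * ell D) by ring, abs_mul, abs_of_nonneg hαℓ]
  have h2 : |1 + c' * alpha D * ell D| ≤ 2 := by
    calc |1 + c' * alpha D * ell D| ≤ |(1 : ℝ)| + |c' * alpha D * ell D| := abs_add_le _ _
      _ ≤ 2 := by rw [abs_one, habs]; linarith
  have h3 : |1 - c' * alpha D * ell D| ≤ 2 := by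
    calc |1 - c' * alpha D * ell D| ≤ |(1 : ℝ)| + |c' * alpha D * ell D| := abs_sub _ _
      _ ≤ 2 := by rw [abs_one, habs]; linarith
  have hn2 : ‖beta2 c' D‖ = 2 * alpha D * |1 + c' * alpha D * ell D| := by
    rw [beta2, norm_mul, norm_mul, norm_mul, Complex.norm_I, Complex.norm_real, Complex.norm_real,
      Real.norm_eq_abs, Real.norm_eq_abs, abs_of_nonneg hα0]
    norm_num
  have hn3 : ‖beta3 c' D‖ = 3 * alpha D * |1 - c' * alpha D * ell D| := by
    rw [beta3, norm_mul, norm_mul, norm_mul, Complex.norm_I, Complex.norm_real, Complex.norm_real,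
      Real.norm_eq_abs, Real.norm_eq_abs, abs_of_nonneg hα0]
    norm_num
  constructor
  · rw [hn2]; nlinarith only [h2, hα0]
  · rw [hn3]; nlinarith only [h3, hα0]

/-- Chebyshev–Mertens at `2T²`: `Σ_{p ≤ 2T²} log p/p ≤ 3𝓛²` for `𝓛 ≥ 3` (`log(2T²) = log 2 + 2𝓛^{1.1}`,
`𝓛^{1.1} ≤ 𝓛²`; the tree's `MertensBound.sum_log_div_prime_le`). [cite: Zhang2022LandauSiegel, §6 p.28 (`T`)] -/
theorem sum_log_div_prime_le_bigT {D : ℕ} (hℓ3 : 3 ≤ ell D) :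
    ∑ p ∈ Nat.primesLE ⌊2 * bigT D ^ 2⌋₊, Real.log p / p ≤ 3 * ell D ^ 2 := by
  have hℓ1 : 1 ≤ ell D := by linarith only [hℓ3]
  have h := MertensBound.sum_log_div_prime_le ⌊2 * bigT D ^ 2⌋₊
  have hT0 : 0 < bigT D := Real.exp_pos _
  have hT1 : (1 : ℝ) ≤ bigT D := Real.one_le_exp (Real.rpow_nonneg (by linarith only [hℓ3]) _)
  have hT2 : (1 : ℝ) ≤ 2 * bigT D ^ 2 := by nlinarith only [hT1]
  have hfl : ((⌊2 * bigT D ^ 2⌋₊ : ℕ) : ℝ) ≤ 2 * bigT D ^ 2 := Nat.floor_le (by positivity)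
  have hfl1 : (1 : ℝ) ≤ ((⌊2 * bigT D ^ 2⌋₊ : ℕ) : ℝ) := by
    have h1 : (1 : ℕ) ≤ ⌊2 * bigT D ^ 2⌋₊ := Nat.le_floor (by exact_mod_cast hT2)
    exact_mod_cast h1
  have hlog : Real.log ((⌊2 * bigT D ^ 2⌋₊ : ℕ) : ℝ) ≤ Real.log 2 + 2 * ell D ^ (1.1 : ℝ) := by
    calc _ ≤ Real.log (2 * bigT D ^ 2) := Real.log_le_log (by linarith only [hfl1]) hfl
      _ = Real.log 2 + 2 * ell D ^ (1.1 : ℝ) := by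
          rw [Real.log_mul (by norm_num) (by positivity), Real.log_pow, bigT, Real.log_exp]; ring
  have hL₁2 : ell D ^ (1.1 : ℝ) ≤ ell D ^ 2 := by
    calc ell D ^ (1.1 : ℝ) ≤ ell D ^ (2 : ℝ) := Real.rpow_le_rpow_of_exponent_le hℓ1 (by norm_num)
      _ = ell D ^ 2 := by norm_cast
  have hl4 : Real.log 4 ≤ 2 := by
    rw [show (4 : ℝ) = 2 * 2 by norm_num, Real.log_mul (by norm_num) (by norm_num)]
    linarith only [Real.log_two_lt_d9]
  have h9 : (3 : ℝ) ≤ ell D ^ 2 := by nlinarith only [hℓ3]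
  linarith only [h, hlog, hL₁2, hl4, h9, Real.log_two_lt_d9]

/-- **The inner window sum at fixed `(q₁,q₂)`**, at a fixed large `D`: with `W(m₁,p) =
|b(q₁m₁)|·|ν₁*(q₂p)|·|κ̄₂(m₁p)|/(m₁p)` and the window condition `T² < 4D⁴p`,
`Σ'_{m₁} Σ'_{p} [window]·W ≤ 24·C_M·B₁·α·(Σ_{p≤2T²} log p/p)·τ(q₁)τ(q₂)`, given the M1 `m₁`-sum bound
with constant `C_M ≥ 0`, `|b₁| ≤ B₁α`, `4D⁸ ≤ T²`, `eD⁴ ≤ T²`, `|β₂|,|β₃| ≤ 10α`, and a support index.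
[cite: Zhang2022LandauSiegel, §17 u021 p.98] -/
theorem inner_window_sum_le {D : ℕ} (χ : DirichletCharacter ℂ D) (c' : ℝ)
    (hℓ3 : 3 ≤ ell D) (hD1 : 1 ≤ D) (hTe : Real.exp 1 * (D : ℝ) ^ 4 ≤ bigT D ^ 2)
    (hT4 : 4 * (D : ℝ) ^ 8 ≤ bigT D ^ 2)
    (hβ2 : ‖beta2 c' D‖ ≤ 10 * alpha D) (hβ3 : ‖beta3 c' D‖ ≤ 10 * alpha D)
    {CM B₁ : ℝ} (hCM : 0 ≤ CM) (hB₁ : 0 ≤ B₁) (hα0 : 0 ≤ alpha D)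
    (hb1 : |b1 c' D| ≤ B₁ * alpha D)
    (hM : ∀ q₁ m₂ : ℕ, 1 ≤ q₁ → 1 ≤ m₂ →
      (∑' m₁ : ℕ, ‖bcoef D (q₁ * m₁)‖ * ‖kappa2bar c' D (m₁ * m₂)‖ / (m₁ : ℝ)) ≤
        CM * (q₁.divisors.card : ℝ) * ‖kappa2bar c' D m₂‖ * ((m₂ : ℝ) / m₂.totient) ^ 2)
    {N : ℕ} (hbN : ∀ q₁ m : ℕ, 1 ≤ q₁ → N ≤ m → bcoef D (q₁ * m) = 0)
    (hνN : ∀ q₂ m : ℕ, 1 ≤ q₂ → N ≤ m → nuOneStar c' χ (q₂ * m) = 0)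
    {q₁ q₂ : ℕ} (hq1 : 1 ≤ q₁) (hq2 : 1 ≤ q₂) (hq2D : q₂ ≤ D ^ 4) :
    (∑' m₁ : ℕ, ∑' m₂ : ℕ,
      if ((D : ℝ) ^ 4 < (q₂ : ℝ) * m₂ ∧ m₂.Prime ∧ Nat.Coprime m₂ q₁) ∧
          bigT D ^ 2 < 4 * (D : ℝ) ^ 4 * m₂ then
        ‖bcoef D (q₁ * m₁)‖ * ‖nuOneStar c' χ (q₂ * m₂)‖ * ‖kappa2bar c' D (m₁ * m₂)‖ /
          ((m₁ : ℝ) * m₂)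
      else 0) ≤
      24 * CM * B₁ * alpha D * (∑ p ∈ Nat.primesLE ⌊2 * bigT D ^ 2⌋₊, Real.log p / p) *
        ((q₁.divisors.card : ℝ) * q₂.divisors.card) := by
  classical
  set SP : ℝ := ∑ p ∈ Nat.primesLE ⌊2 * bigT D ^ 2⌋₊, Real.log p / p with hSPdef
  set A : ℝ := 24 * CM * B₁ * alpha D * ((q₁.divisors.card : ℝ) * q₂.divisors.card) with hA
  have hA0 : 0 ≤ A := by rw [hA]; positivity
  -- the summand as a function
  set G : ℕ → ℕ → ℝ := fun m₁ m₂ =>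
    if ((D : ℝ) ^ 4 < (q₂ : ℝ) * m₂ ∧ m₂.Prime ∧ Nat.Coprime m₂ q₁) ∧
        bigT D ^ 2 < 4 * (D : ℝ) ^ 4 * m₂ then
      ‖bcoef D (q₁ * m₁)‖ * ‖nuOneStar c' χ (q₂ * m₂)‖ * ‖kappa2bar c' D (m₁ * m₂)‖ /
        ((m₁ : ℝ) * m₂)
    else 0 with hG
  show (∑' m₁ : ℕ, ∑' m₂ : ℕ, G m₁ m₂) ≤ 24 * CM * B₁ * alpha D * SP *
    ((q₁.divisors.card : ℝ) * q₂.divisors.card)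
  -- finite double sum, swapped
  have hfin : (∑' m₁ : ℕ, ∑' m₂ : ℕ, G m₁ m₂) =
      ∑ m₂ ∈ Finset.range N, ∑ m₁ ∈ Finset.range N, G m₁ m₂ := by
    rw [tsum_tsum_eq_sum_sum_of_vanish' G N ?_ ?_, Finset.sum_comm]
    · intro m₁ m₂ hm₁
      have hb0 : bcoef D (q₁ * m₁) = 0 := hbN q₁ m₁ hq1 hm₁
      simp only [hG, hb0, norm_zero, zero_mul, zero_div, ite_self]
    · intro m₁ m₂ hm₂
      have hν0 : nuOneStar c' χ (q₂ * m₂) = 0 := hνN q₂ m₂ hq2 hm₂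
      simp only [hG, hν0, norm_zero, mul_zero, zero_mul, zero_div, ite_self]
  rw [hfin]
  -- each `m₂`-slice
  have hslice : ∀ m₂ ∈ Finset.range N, (∑ m₁ ∈ Finset.range N, G m₁ m₂) ≤
      if m₂.Prime ∧ (m₂ : ℝ) < 2 * bigT D ^ 2 then A * (Real.log m₂ / m₂) else 0 := by
    intro m₂ _
    by_cases hc : ((D : ℝ) ^ 4 < (q₂ : ℝ) * m₂ ∧ m₂.Prime ∧ Nat.Coprime m₂ q₁) ∧
        bigT D ^ 2 < 4 * (D : ℝ) ^ 4 * m₂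
    · obtain ⟨⟨_, hpr, _⟩, hwin⟩ := hc
      have hm0 : (0 : ℝ) < m₂ := by exact_mod_cast hpr.pos
      have hpD : D ^ 4 < m₂ := by
        have hD4 : (0 : ℝ) < (D : ℝ) ^ 4 := by positivity
        have h : (D : ℝ) ^ 4 * (4 * (D : ℝ) ^ 4) < m₂ * (4 * (D : ℝ) ^ 4) := by
          calc (D : ℝ) ^ 4 * (4 * (D : ℝ) ^ 4) = 4 * (D : ℝ) ^ 8 := by ring
            _ < 4 * (D : ℝ) ^ 4 * m₂ := lt_of_le_of_lt hT4 hwin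
            _ = m₂ * (4 * (D : ℝ) ^ 4) := by ring
        have h' : ((D ^ 4 : ℕ) : ℝ) < m₂ := by
          push_cast; exact lt_of_mul_lt_mul_right h (by positivity)
        exact_mod_cast h'
      -- the `m₁`-sum
      have hm1 : (∑ m₁ ∈ Finset.range N, G m₁ m₂) =
          (‖nuOneStar c' χ (q₂ * m₂)‖ / m₂) *
            ∑' m₁ : ℕ, ‖bcoef D (q₁ * m₁)‖ * ‖kappa2bar c' D (m₁ * m₂)‖ / (m₁ : ℝ) := by
        rw [tsum_eq_sum (s := Finset.range N) (fun m₁ hm₁ => by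
          have hm₁' : N ≤ m₁ := by simpa using hm₁
          rw [hbN q₁ m₁ hq1 hm₁', norm_zero, zero_mul, zero_div]), Finset.mul_sum]
        refine Finset.sum_congr rfl fun m₁ _ => ?_
        have hc' : ((D : ℝ) ^ 4 < (q₂ : ℝ) * m₂ ∧ m₂.Prime ∧ Nat.Coprime m₂ q₁) ∧
            bigT D ^ 2 < 4 * (D : ℝ) ^ 4 * m₂ := ⟨⟨‹_›, hpr, ‹_›⟩, hwin⟩
        simp only [hG]
        rw [if_pos hc']
        rcases Nat.eq_zero_or_pos m₁ with rfl | hm₁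
        · simp
        · have hm1' : (m₁ : ℝ) ≠ 0 := by exact_mod_cast hm₁.ne'
          field_simp
      have hMb := hM q₁ m₂ hq1 hpr.one_lt.le
      have hκ : ‖kappa2bar c' D m₂‖ ≤ B₁ * alpha D * Real.log m₂ := by
        rw [kappa2bar_eq_kappa₂_neg]
        refine (MeanSquareMajorant.norm_kappa₂_prime_le _ hpr).trans ?_
        rw [abs_neg]
        exact mul_le_mul_of_nonneg_right hb1 (Real.log_natCast_nonneg _)
      have hφ : ((m₂ : ℝ) / m₂.totient) ^ 2 ≤ 4 := by
        rw [Nat.totient_prime hpr]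
        have h2 : (2 : ℝ) ≤ m₂ := by exact_mod_cast hpr.two_le
        have hsub : ((m₂ - 1 : ℕ) : ℝ) = (m₂ : ℝ) - 1 := by
          rw [Nat.cast_sub hpr.one_lt.le]; simp
        rw [hsub, div_pow, div_le_iff₀ (by nlinarith only [h2])]
        nlinarith only [h2]
      have hlog0 : 0 ≤ Real.log m₂ := Real.log_natCast_nonneg _
      have hτ1 : (0 : ℝ) ≤ q₁.divisors.card := Nat.cast_nonneg _
      have hm1sum : (∑' m₁ : ℕ, ‖bcoef D (q₁ * m₁)‖ * ‖kappa2bar c' D (m₁ * m₂)‖ / (m₁ : ℝ)) ≤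
          CM * q₁.divisors.card * (B₁ * alpha D * Real.log m₂) * 4 := by
        refine hMb.trans ?_
        have h0 : 0 ≤ CM * (q₁.divisors.card : ℝ) := mul_nonneg hCM hτ1
        exact mul_le_mul (mul_le_mul_of_nonneg_left hκ h0) hφ (sq_nonneg _)
          (mul_nonneg h0 (by positivity))
      by_cases hsmall : (m₂ : ℝ) < 2 * bigT D ^ 2
      · rw [if_pos ⟨hpr, hsmall⟩, hm1]
        have hν := norm_nuOneStar_mul_prime_le χ c' hℓ3 hD1 hTe hβ2 hβ3 hpr hpD hq2 hq2D
        calc ‖nuOneStar c' χ (q₂ * m₂)‖ / m₂ *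
              (∑' m₁ : ℕ, ‖bcoef D (q₁ * m₁)‖ * ‖kappa2bar c' D (m₁ * m₂)‖ / (m₁ : ℝ))
            ≤ (6 * q₂.divisors.card / m₂) *
                (CM * q₁.divisors.card * (B₁ * alpha D * Real.log m₂) * 4) := by
              refine mul_le_mul (div_le_div_of_nonneg_right hν hm0.le) hm1sum
                (tsum_nonneg fun _ => by positivity) (by positivity)
          _ = A * (Real.log m₂ / m₂) := by rw [hA, div_eq_mul_inv, div_eq_mul_inv]; ring
      · rw [if_neg (fun h => hsmall h.2), hm1]
        have hν0 : nuOneStar c' χ (q₂ * m₂) = 0 :=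
          nuOneStar_mul_prime_eq_zero χ c' hpr hpD (not_lt.mp hsmall) hq2 hq2D
        rw [hν0, norm_zero, zero_div, zero_mul]
    · have : (∑ m₁ ∈ Finset.range N, G m₁ m₂) = 0 :=
        Finset.sum_eq_zero fun m₁ _ => by simp only [hG, hc, if_false]
      rw [this]
      split_ifs
      · exact mul_nonneg hA0 (div_nonneg (Real.log_natCast_nonneg _) (Nat.cast_nonneg _))
      · exact le_rfl
  refine (Finset.sum_le_sum hslice).trans ?_
  -- compare with the full prime sum up to `2T²`
  rw [← Finset.sum_filter]
  have hsub : (Finset.range N).filter (fun m₂ : ℕ => m₂.Prime ∧ (m₂ : ℝ) < 2 * bigT D ^ 2) ⊆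
      Nat.primesLE ⌊2 * bigT D ^ 2⌋₊ := by
    intro m₂ hm
    simp only [Finset.mem_filter] at hm
    rw [Nat.primesLE_eq_filter_range, Finset.mem_filter, Finset.mem_range]
    refine ⟨?_, hm.2.1⟩
    have : m₂ ≤ ⌊2 * bigT D ^ 2⌋₊ := Nat.le_floor hm.2.2.le
    omega
  calc ∑ m₂ ∈ (Finset.range N).filter (fun m₂ : ℕ => m₂.Prime ∧ (m₂ : ℝ) < 2 * bigT D ^ 2),
        A * (Real.log m₂ / m₂)
      ≤ ∑ m₂ ∈ Nat.primesLE ⌊2 * bigT D ^ 2⌋₊, A * (Real.log m₂ / m₂) :=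
        Finset.sum_le_sum_of_subset_of_nonneg hsub (fun m₂ _ _ =>
          mul_nonneg hA0 (div_nonneg (Real.log_natCast_nonneg _) (Nat.cast_nonneg _)))
    _ = A * SP := by rw [hSPdef, Finset.mul_sum]
    _ = 24 * CM * B₁ * alpha D * SP * ((q₁.divisors.card : ℝ) * q₂.divisors.card) := by
        rw [hA]; ring

/-- **THE WINDOW PIECE OF `R1Rel` (cut M2L-p, window half).** Modulo the `𝔞`-currency square count
`hA1c` (A1 line: `Σ_{l<D⁴}|ν(l)|/l·Σ_{q₁q₂=l}τ(q₁)τ(q₂) ≤ C(𝔞+1)²𝓛`), for every `ε > 0`, eventually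
in `D`, under (A):
`Σ_{l<D⁴}|ν(l)|/l Σ_{q₁q₂=l} Σ'_{m₁} Σ'_{m₂} [D⁴ < q₂m₂ ∧ m₂ prime ∧ (m₂,q₁)=1 ∧ T² < 4D⁴m₂]·
  |b(q₁m₁)|·|ν₁*(q₂m₂)|·|κ̄₂(m₁m₂)|/(m₁m₂) ≤ ε·(𝔞+1)` — the `hLp` hypothesis of
`Phi3Eval.step17_u021Chi_R1Rel_of_split` restricted to the `T²`-cutoff window `bigT D ^ 2 < 4·D⁴·m₂`
(the bulk `4·D⁴·p ≤ T²` is the complementary piece). Route: `inner_window_sum_le` (`|ν₁*(q₂p)| ≤ 6τ(q₂)`,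
M1 `m1Sum_le`, `|κ̄₂(p)| ≤ |b₁|log p`), Chebyshev–Mertens `Σ_{p≤2T²} log p/p ≤ 3𝓛²`, `hA1c`, and
`𝔞 ≤ (96e⁹/π²)𝓛⁴` ⇒ `≪ 𝓛⁻²(𝔞+1)`. [cite: Zhang2022LandauSiegel, §17 u021 p.98] -/
theorem R1_prime_window_small (c' : ℝ)
    (hA1c : ∃ C : ℝ, ForAllLarge fun D _ χ => AssumptionA D χ →
      ∑ l ∈ Finset.Ico 1 (D ^ 4), ‖nu χ l‖ / l *
        ∑ q ∈ l.divisorsAntidiagonal, (q.1.divisors.card : ℝ) * q.2.divisors.card ≤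
          C * (frakA χ + 1) ^ 2 * ell D) :
    ∀ ε : ℝ, 0 < ε → ForAllLarge fun D _ χ => AssumptionA D χ →
      (∑ l ∈ Finset.Ico 1 (D ^ 4), ‖nu χ l‖ / l *
          ∑ q ∈ l.divisorsAntidiagonal, ∑' m₁ : ℕ, ∑' m₂ : ℕ,
            if ((D : ℝ) ^ 4 < (q.2 : ℝ) * m₂ ∧ m₂.Prime ∧ Nat.Coprime m₂ q.1) ∧
                bigT D ^ 2 < 4 * (D : ℝ) ^ 4 * m₂ then
              ‖bcoef D (q.1 * m₁)‖ * ‖nuOneStar c' χ (q.2 * m₂)‖ * ‖kappa2bar c' D (m₁ * m₂)‖ /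
                ((m₁ : ℝ) * m₂)
            else 0) ≤ ε * (frakA χ + 1) := by
  classical
  intro ε hε
  obtain ⟨CM, DM, hM⟩ := m1Sum_le c'
  obtain ⟨CA, DA, hA1⟩ := hA1c
  obtain ⟨DT, hT4⟩ := four_mul_pow_eight_le_bigT_sq
  set B₁ : ℝ := 1 + 5 * |c'| * π with hB₁
  have hB₁0 : 0 ≤ B₁ := by rw [hB₁]; positivity
  set A₄ : ℝ := 96 * Real.exp 9 / π ^ 2 + 1 with hA₄
  have hA₄0 : 0 ≤ A₄ := by rw [hA₄]; positivity
  -- the final constant: total ≤ K·𝓛⁻²·(𝔞+1)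
  set K : ℝ := 72 * max CM 0 * B₁ * π * max CA 0 * A₄ with hK
  have hK0 : 0 ≤ K := by rw [hK]; positivity
  obtain ⟨Dℓ, hDℓ⟩ : ∃ D₀ : ℕ, ∀ D : ℕ, D₀ ≤ D → max 3 (max (|c'| * π) (K / ε + 1)) ≤ ell D := by
    refine ⟨⌈Real.exp (max 3 (max (|c'| * π) (K / ε + 1)))⌉₊, fun D hD => ?_⟩
    have h1 : Real.exp (max 3 (max (|c'| * π) (K / ε + 1))) ≤ D :=
      (Nat.le_ceil _).trans (by exact_mod_cast hD)
    calc _ = Real.log (Real.exp (max 3 (max (|c'| * π) (K / ε + 1)))) := (Real.log_exp _).symm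
      _ ≤ Real.log D := Real.log_le_log (Real.exp_pos _) h1
      _ = ell D := rfl
  refine ⟨max (max DM DA) (max DT (max Dℓ 1)), fun D _ χ hD hq hp hA => ?_⟩
  have hDM : DM ≤ D := le_trans (le_trans (le_max_left _ _) (le_max_left _ _)) hD
  have hDA : DA ≤ D := le_trans (le_trans (le_max_right _ _) (le_max_left _ _)) hD
  have hDT : DT ≤ D := le_trans (le_trans (le_max_left _ _) (le_max_right _ _)) hD
  have hDℓ' : Dℓ ≤ D :=
    le_trans (le_trans (le_trans (le_max_left _ _) (le_max_right _ _)) (le_max_right _ _)) hD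
  have hD1 : 1 ≤ D :=
    le_trans (le_trans (le_trans (le_max_right _ _) (le_max_right _ _)) (le_max_right _ _)) hD
  have hℓM := hDℓ D hDℓ'
  have hℓ3 : 3 ≤ ell D := le_trans (le_max_left _ _) hℓM
  have hℓc : |c'| * π ≤ ell D := le_trans (le_trans (le_max_left _ _) (le_max_right _ _)) hℓM
  have hℓK : K / ε + 1 ≤ ell D := le_trans (le_trans (le_max_right _ _) (le_max_right _ _)) hℓM
  have hℓ1 : 1 ≤ ell D := by linarith only [hℓ3]
  have hℓ0 : 0 < ell D := by linarith only [hℓ3]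
  have hα : alpha D = π / ell D ^ 9 := by rw [alpha, bigP, Real.log_exp]
  have hα0 : 0 < alpha D := by rw [hα]; positivity
  have hT4D := hT4 D hDT
  -- `e·D⁴ ≤ 4D⁸ ≤ T²`
  have hTe : Real.exp 1 * (D : ℝ) ^ 4 ≤ bigT D ^ 2 := by
    have hD1' : (1 : ℝ) ≤ (D : ℝ) ^ 4 := one_le_pow₀ (by exact_mod_cast hD1)
    have he : Real.exp 1 ≤ 4 := by have := Real.exp_one_lt_d9; linarith only [this]
    have h4 : (0 : ℝ) ≤ (D : ℝ) ^ 4 := by positivity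
    calc Real.exp 1 * (D : ℝ) ^ 4 ≤ 4 * ((D : ℝ) ^ 4 * (D : ℝ) ^ 4) := by nlinarith only [hD1', he, h4]
      _ = 4 * (D : ℝ) ^ 8 := by ring
      _ ≤ bigT D ^ 2 := hT4D
  -- `|c′|α𝓛 ≤ 1`, the `β` sizes, `|b₁| ≤ B₁α`
  have hcαℓ : |c'| * (alpha D * ell D) ≤ 1 := by
    have h8 : alpha D * ell D ≤ π / ell D := by
      rw [hα, div_mul_eq_mul_div, div_le_div_iff₀ (by positivity) hℓ0]
      have : ell D * ell D ≤ ell D ^ 9 := by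
        calc ell D * ell D = ell D ^ 2 := by ring
          _ ≤ ell D ^ 9 := pow_le_pow_right₀ hℓ1 (by norm_num)
      nlinarith only [Real.pi_pos, this]
    have hc0 : 0 ≤ |c'| := abs_nonneg _
    calc |c'| * (alpha D * ell D) ≤ |c'| * (π / ell D) := mul_le_mul_of_nonneg_left h8 hc0
      _ = |c'| * π / ell D := by ring
      _ ≤ 1 := by rw [div_le_one hℓ0]; exact hℓc
  obtain ⟨hβ2, hβ3⟩ := norm_beta23_le c' hα0.le hcαℓ
  have hb1 : |b1 c' D| ≤ B₁ * alpha D := abs_b1_le_const_mul_alpha c' hℓ1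
  -- supports and the M1 bound at this `D`
  obtain ⟨N, hbN, hνN⟩ := exists_R1_support_window χ c'
  have hM' : ∀ q₁ m₂ : ℕ, 1 ≤ q₁ → 1 ≤ m₂ →
      (∑' m₁ : ℕ, ‖bcoef D (q₁ * m₁)‖ * ‖kappa2bar c' D (m₁ * m₂)‖ / (m₁ : ℝ)) ≤
        max CM 0 * (q₁.divisors.card : ℝ) * ‖kappa2bar c' D m₂‖ * ((m₂ : ℝ) / m₂.totient) ^ 2 := by
    intro q₁ m₂ h1 h2
    refine (hM D χ hDM hq hp q₁ m₂ h1 h2).trans ?_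
    gcongr
    exact le_max_left _ _
  -- §A: the inner sums
  set SP : ℝ := ∑ p ∈ Nat.primesLE ⌊2 * bigT D ^ 2⌋₊, Real.log p / p with hSPdef
  have hSP : SP ≤ 3 * ell D ^ 2 := sum_log_div_prime_le_bigT hℓ3
  have hSP0 : 0 ≤ SP := Finset.sum_nonneg fun p _ =>
    div_nonneg (Real.log_natCast_nonneg _) (Nat.cast_nonneg _)
  have hinner : ∀ l ∈ Finset.Ico 1 (D ^ 4), ∀ q ∈ l.divisorsAntidiagonal,
      (∑' m₁ : ℕ, ∑' m₂ : ℕ,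
        if ((D : ℝ) ^ 4 < (q.2 : ℝ) * m₂ ∧ m₂.Prime ∧ Nat.Coprime m₂ q.1) ∧
            bigT D ^ 2 < 4 * (D : ℝ) ^ 4 * m₂ then
          ‖bcoef D (q.1 * m₁)‖ * ‖nuOneStar c' χ (q.2 * m₂)‖ * ‖kappa2bar c' D (m₁ * m₂)‖ /
            ((m₁ : ℝ) * m₂)
        else 0) ≤
        24 * max CM 0 * B₁ * alpha D * SP * ((q.1.divisors.card : ℝ) * q.2.divisors.card) := by
    intro l hl q hqd
    have hl' := Finset.mem_Ico.mp hl
    have hqq := Nat.mem_divisorsAntidiagonal.mp hqd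
    have hq1 : 1 ≤ q.1 := Nat.one_le_iff_ne_zero.mpr (left_ne_zero_of_mul (hqq.1 ▸ hqq.2))
    have hq2 : 1 ≤ q.2 := Nat.one_le_iff_ne_zero.mpr (right_ne_zero_of_mul (hqq.1 ▸ hqq.2))
    have hq2D : q.2 ≤ D ^ 4 := by
      have : q.2 ≤ l := Nat.le_of_dvd (by omega)
        (Nat.snd_mem_divisors_of_mem_antidiagonal hqd |> Nat.dvd_of_mem_divisors)
      omega
    exact inner_window_sum_le χ c' hℓ3 hD1 hTe hT4D hβ2 hβ3 (le_max_right CM 0) hB₁0 hα0.le hb1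
      hM' hbN hνN hq1 hq2 hq2D
  -- §B: the outer sum
  have hAo := hA1 D χ hDA hq hp hA
  have hfrakA0 : 0 ≤ frakA χ := frakA_nonneg χ
  have hfrakA : frakA χ ≤ (A₄ - 1) * ell D ^ 4 := by
    have h := Section8Ded823.frakA_le_ell_pow_four χ hp hℓ3
    rw [hA₄]; simpa using h
  have houter : (∑ l ∈ Finset.Ico 1 (D ^ 4), ‖nu χ l‖ / l *
      ∑ q ∈ l.divisorsAntidiagonal, ∑' m₁ : ℕ, ∑' m₂ : ℕ,
        if ((D : ℝ) ^ 4 < (q.2 : ℝ) * m₂ ∧ m₂.Prime ∧ Nat.Coprime m₂ q.1) ∧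
            bigT D ^ 2 < 4 * (D : ℝ) ^ 4 * m₂ then
          ‖bcoef D (q.1 * m₁)‖ * ‖nuOneStar c' χ (q.2 * m₂)‖ * ‖kappa2bar c' D (m₁ * m₂)‖ /
            ((m₁ : ℝ) * m₂)
        else 0) ≤
      (24 * max CM 0 * B₁ * alpha D * SP) * (max CA 0 * (frakA χ + 1) ^ 2 * ell D) := by
    have h0 : 0 ≤ 24 * max CM 0 * B₁ * alpha D * SP := by positivity
    calc _ ≤ ∑ l ∈ Finset.Ico 1 (D ^ 4), ‖nu χ l‖ / l *
          ∑ q ∈ l.divisorsAntidiagonal,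
            24 * max CM 0 * B₁ * alpha D * SP * ((q.1.divisors.card : ℝ) * q.2.divisors.card) := by
          refine Finset.sum_le_sum fun l hl => mul_le_mul_of_nonneg_left
            (Finset.sum_le_sum fun q hq' => hinner l hl q hq') ?_
          exact div_nonneg (norm_nonneg _) (Nat.cast_nonneg _)
      _ = (24 * max CM 0 * B₁ * alpha D * SP) * (∑ l ∈ Finset.Ico 1 (D ^ 4), ‖nu χ l‖ / (l : ℝ) *
          ∑ q ∈ l.divisorsAntidiagonal, ((q.1.divisors.card : ℝ) * (q.2.divisors.card : ℝ))) := by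
          simp only [Finset.mul_sum]
          refine Finset.sum_congr rfl fun l _ => Finset.sum_congr rfl fun q _ => ?_
          ring
      _ ≤ (24 * max CM 0 * B₁ * alpha D * SP) * (max CA 0 * (frakA χ + 1) ^ 2 * ell D) := by
          refine mul_le_mul_of_nonneg_left (hAo.trans ?_) h0
          have : 0 ≤ (frakA χ + 1) ^ 2 * ell D := by positivity
          nlinarith only [le_max_left CA 0, this]
  refine houter.trans ?_
  -- §C: `24·CM·B₁·α·3𝓛²·CA·(𝔞+1)²·𝓛 ≤ K𝓛⁻²(𝔞+1) ≤ ε(𝔞+1)`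
  have hsq : (frakA χ + 1) ^ 2 ≤ (frakA χ + 1) * (A₄ * ell D ^ 4) := by
    rw [sq]
    refine mul_le_mul_of_nonneg_left ?_ (by linarith only [hfrakA0])
    have : (1 : ℝ) ≤ ell D ^ 4 := one_le_pow₀ hℓ1
    nlinarith only [hfrakA, this]
  have hstep : (24 * max CM 0 * B₁ * alpha D * SP) * (max CA 0 * (frakA χ + 1) ^ 2 * ell D) ≤
      (24 * max CM 0 * B₁ * alpha D * (3 * ell D ^ 2)) *
        (max CA 0 * ((frakA χ + 1) * (A₄ * ell D ^ 4)) * ell D) := by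
    have h1 : 0 ≤ 24 * max CM 0 * B₁ * alpha D := by positivity
    have h2 : 0 ≤ max CA 0 := le_max_right _ _
    have hX : 24 * max CM 0 * B₁ * alpha D * SP ≤ 24 * max CM 0 * B₁ * alpha D * (3 * ell D ^ 2) :=
      mul_le_mul_of_nonneg_left hSP h1
    have hY : max CA 0 * (frakA χ + 1) ^ 2 * ell D ≤
        max CA 0 * ((frakA χ + 1) * (A₄ * ell D ^ 4)) * ell D :=
      mul_le_mul_of_nonneg_right (mul_le_mul_of_nonneg_left hsq h2) hℓ0.le
    exact mul_le_mul hX hY (by positivity) (by positivity)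
  refine hstep.trans ?_
  have hid : (24 * max CM 0 * B₁ * alpha D * (3 * ell D ^ 2)) *
      (max CA 0 * ((frakA χ + 1) * (A₄ * ell D ^ 4)) * ell D) = K / ell D ^ 2 * (frakA χ + 1) := by
    rw [hK, hα]; field_simp; ring
  rw [hid]
  refine mul_le_mul_of_nonneg_right ?_ (by linarith only [hfrakA0])
  rw [div_le_iff₀ (by positivity)]
  have h1 : K / ε ≤ ell D := by linarith only [hℓK]
  have h2 : K ≤ ε * ell D := by
    have := (div_le_iff₀ hε).mp h1; linarith only [this]
  calc K ≤ ε * ell D := h2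
    _ ≤ ε * ell D ^ 2 := by
        refine mul_le_mul_of_nonneg_left ?_ hε.le
        calc ell D = ell D ^ 1 := (pow_one _).symm
          _ ≤ ell D ^ 2 := pow_le_pow_right₀ hℓ1 (by norm_num)

end Literature.NumberTheory.LFunctions.Zhang2022.Typed.Section17
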